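import Summits.ResolutionOfSingularities.ResolutionOfSingularities.Theorems.FrobeniusLadderFRationalResolutionMonomialMembershipDform
import Literature.RingTheory.RegularLocalRing.RegularQuotient
import HarnessLib

/-!
# Crux `FrobeniusLadder.FRationalResolution` (stmt-ResolutionOfSingularities-15317), line `redirect`,
# stub `stub_diagonalizableQuotientResolution` — KATO'S REGULARITY CRITERION (brick (θ) of the repair census):
# a log regular local ring which is regular has its sharp stalk monoid generated by `rank` elements

K. Kato, *Toric singularities* (1994): for a log regular `(X, M)` the underlying scheme is regular at `x` iff
`M̄_x = M_x/𝒪^*_x ≅ ℕ^r`. The tree proves «⇐» (`LogRegularFreeStalk.lean`, the last step of (10.4)). This file proves the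
substance of «⇒» in the tree's one-chart currency (`LogChart.IsLogRegularAt`): if `φ : P → A` is log regular at `𝔭` and `A_𝔭` is
a REGULAR local ring, then `P` is generated modulo `ℤ F_𝔭` by a finite set `Q` of NON-unit elements with
`#Q ≤ n − rk F_𝔭^{gp} = rank (P^{gp}/F_𝔭^{gp})` — so the sharp monoid `P/F_𝔭` (of that rank) is free on `Q`.

* `exists_finset_subset_span_eq_of_isRegularLocalRing_quotient` — Bruns–Herzog Prop. 2.2.4 «only if» WITH THE GENERATORS
  CHOSEN INSIDE A GIVEN GENERATING SET `G` of `I`: `R`, `R/I` regular local, `(G) = I` ⇒ `I = (S)` for a finite `S ⊆ G` with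
  `dim R/I + #S = dim R` (the images of `G` span `(I + 𝔪²)/𝔪²`; an independent spanning subfamily is part of a regular system
  of parameters; equal `dim R/−` of the two primes);
* **`LogChart.exists_generators_mod_faceMonoid_of_isRegularLocalRing`** — THE CRITERION: Kato's ideal `I(𝔭) A_𝔭 = (φ(P ∖ F_𝔭))`
  has `A_𝔭/I(𝔭)` regular (Def. (2.1)(i)) and `dim A_𝔭 = dim A_𝔭/I(𝔭) + (n − rk F^{gp})` ((2.1)(ii)), so for `A_𝔭` regular it is
  generated by `n − rk F^{gp}` monomials `φ(Q)`; by the combinatorial membership lemma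
  (`LogChart.forall_exists_sub_sum_nsmul_mem_span_faceMonoid`, `…MonomialMembershipDform`) these `Q` generate `P` modulo `ℤ F_𝔭`.

Consumer: the isolated-singularity case of the stub (a quotient-chart point under an ISOLATED singular point has all proper
faces of its cone regular — the cosupport condition of brick T1, `…PrimaryMonomialCentre`). Honest label: generic local
algebra (no stub closed by name). No definitions, no named facts, no sorry.
[cite: Kato1994, Def. (2.1), (3.2), (6.1), (10.4)] [cite: BrunsHerzog1998, §2.2 Prop. 2.2.4, p. 67] [cite: Niziol2006, Lemma 2.4]
-/

noncomputable section

-- single-problem summit: the doubled namespace component is forced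
set_option linter.dupNamespace false

namespace Summit.ResolutionOfSingularities.ResolutionOfSingularities.Theorems.FRationalResolution.KatoRegularityCriterion

universe u

open IsLocalRing Module Literature.AlgebraicGeometry.Resolution Literature.RingTheory.RegularLocalRing

/-- **Bruns–Herzog Prop. 2.2.4 «only if», generators inside a given generating set.** Let `R` be a regular local ring, `I`
an ideal with `R/I` regular, and `G ⊆ R` with `(G) = I`. Then `I = (S)` for a finite `S ⊆ G` with `dim R/I + #S = dim R`
(the images of `G` span the kernel `(I + 𝔪²)/𝔪²` of `𝔪/𝔪² → 𝔫/𝔫²`, of dimension `dim R − dim R/I`; an independent spanning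
subfamily is part of a regular system of parameters, `R/(S)` is regular of dimension `dim R/I`, and the primes `(S) ⊆ I`
coincide). [cite: BrunsHerzog1998, §2.2 Prop. 2.2.4, p. 67] [cite: Matsumura1987, §14 Thm. 14.2] -/
theorem exists_finset_subset_span_eq_of_isRegularLocalRing_quotient {R : Type u} [CommRing R] [IsRegularLocalRing R]
    (I : Ideal R) [IsRegularLocalRing (R ⧸ I)] (G : Set R) (hG : Ideal.span G = I) :
    ∃ S : Finset R, (S : Set R) ⊆ G ∧ Ideal.span (S : Set R) = I ∧
      ringKrullDim (R ⧸ I) + (S.card : WithBot ℕ∞) = ringKrullDim R := by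
  classical
  have hItop : I ≠ ⊤ := Ideal.Quotient.nontrivial_iff.mp inferInstance
  have hIm : I ≤ maximalIdeal R := le_maximalIdeal hItop
  have hGm : G ⊆ (maximalIdeal R : Set R) := fun g hg => hIm (hG ▸ Ideal.subset_span hg)
  have hGI : G ⊆ (I : Set R) := fun g hg => hG ▸ Ideal.subset_span hg
  haveI : IsLocalHom (algebraMap R (R ⧸ I)) := IsLocalHom.of_surjective _ Ideal.Quotient.mk_surjective
  have hcount := spanFinrank_maximalIdeal_add_finrank_eq_of_surjective (R := R) (S := R ⧸ I)
    Ideal.Quotient.mk_surjective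
  have hker : RingHom.ker (algebraMap R (R ⧸ I)) = I := Ideal.mk_ker
  rw [hker] at hcount
  set N : Submodule R (maximalIdeal R) := Submodule.comap (maximalIdeal R).subtype I with hNdef
  -- `G` seen inside `𝔪`, and `N = span_R G̃`
  set Gt : Set (maximalIdeal R) := Set.range (Set.inclusion hGm) with hGtdef
  have hNspan : N = Submodule.span R Gt := by
    have eqmap : Ideal.span G = (Submodule.span R Gt).map (maximalIdeal R).subtype := by
      rw [Submodule.map_span, Ideal.submodule_span_eq]
      congr 1
      ext x
      constructor
      · intro hx
        exact ⟨⟨x, hGm hx⟩, ⟨⟨x, hx⟩, rfl⟩, rfl⟩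
      · rintro ⟨y, ⟨g, rfl⟩, rfl⟩
        exact g.2
    rw [hNdef, ← hG, eqmap, Submodule.comap_map_eq_of_injective (maximalIdeal R).subtype_injective]
  have hspan_eq : Submodule.span (ResidueField R) ((maximalIdeal R).toCotangent '' (N : Set (maximalIdeal R))) =
      Submodule.span (ResidueField R) ((maximalIdeal R).toCotangent '' Gt) := by
    apply le_antisymm
    · rw [Submodule.span_le]
      rintro _ ⟨x, hx, rfl⟩
      have hx' : x ∈ Submodule.span R Gt := hNspan ▸ hx
      have h1 : (maximalIdeal R).toCotangent x ∈ (Submodule.span R Gt).map (maximalIdeal R).toCotangent :=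
        Submodule.mem_map_of_mem hx'
      rw [Submodule.map_span] at h1
      exact Submodule.span_le_restrictScalars R (ResidueField R) _ h1
    · refine Submodule.span_mono (Set.image_mono ?_)
      rintro x ⟨g, rfl⟩
      show ((Set.inclusion hGm g : maximalIdeal R) : R) ∈ I
      exact hGI g.2
  -- an independent spanning subfamily of the images of `G̃`
  let v : ↥Gt → CotangentSpace R := fun x => (maximalIdeal R).toCotangent x.1
  obtain ⟨κ, a, ha, hspan, hli⟩ := exists_linearIndependent' (ResidueField R) v
  haveI : Finite κ := hli.finite_of_isNoetherian
  let _ : Fintype κ := Fintype.ofFinite κ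
  have hrange : Submodule.span (ResidueField R) ((maximalIdeal R).toCotangent '' (N : Set (maximalIdeal R))) =
      Submodule.span (ResidueField R) (Set.range (v ∘ a)) := by
    rw [hspan_eq, hspan, Set.image_eq_range]
  rw [hrange, finrank_span_eq_card hli] at hcount
  -- the elements `x_i ∈ G`
  let g : κ → R := fun i => (((a i).1 : maximalIdeal R) : R)
  have hg_inj : Function.Injective g := fun i j h => ha (Subtype.ext (Subtype.ext h))
  have hgG : ∀ i, g i ∈ G := by
    intro i
    obtain ⟨x, hx⟩ := (a i).2
    rw [← show ((x : R)) = g i from congrArg (fun y : maximalIdeal R => (y : R)) hx]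
    exact x.2
  have hgI : ∀ i, g i ∈ I := fun i => hGI (hgG i)
  have hgm : ∀ i, g i ∈ maximalIdeal R := fun i => ((a i).1 : maximalIdeal R).2
  let S : Finset R := Finset.univ.image g
  have hScoe : (S : Set R) = Set.range g := by simp [S]
  have hScard : S.card = Fintype.card κ := Finset.card_image_of_injective _ hg_inj
  have sub : (S : Set R) ⊆ maximalIdeal R := by
    rw [hScoe]
    rintro _ ⟨i, rfl⟩
    exact hgm i
  have hSI : Ideal.span (S : Set R) ≤ I := by
    rw [hScoe, Ideal.span_le]
    rintro _ ⟨i, rfl⟩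
    exact hgI i
  have hSG : (S : Set R) ⊆ G := by
    rw [hScoe]
    rintro _ ⟨i, rfl⟩
    exact hgG i
  -- linear independence of the images of `S` in `𝔪/𝔪²`
  have hliS : LinearIndependent (ResidueField R) ((⇑(maximalIdeal R).toCotangent).comp (Set.inclusion sub)) := by
    let e : κ ≃ (S : Set R) := (Equiv.ofInjective g hg_inj).trans (Equiv.setCongr hScoe.symm)
    refine (linearIndependent_equiv e).mp ?_
    convert hli using 1
    funext i
    simp only [Function.comp_apply, v]
    congr 1
  -- Matsumura 14.2
  obtain ⟨hSreg, hSdim⟩ := ((quotient_isRegularLocalRing_tfae R S sub).out 1 2).mp hliS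
  -- both `(S)` and `I` are primes with `dim R/(S) = dim R/I`
  haveI : IsDomain (R ⧸ Ideal.span (S : Set R)) := isDomain_of_isRegularLocalRing _
  haveI : IsDomain (R ⧸ I) := isDomain_of_isRegularLocalRing _
  haveI : (Ideal.span (S : Set R)).IsPrime := (Ideal.Quotient.isDomain_iff_prime _).mp inferInstance
  haveI : I.IsPrime := (Ideal.Quotient.isDomain_iff_prime _).mp inferInstance
  have hR : ((maximalIdeal R).spanFinrank : WithBot ℕ∞) = ringKrullDim R := (isRegularLocalRing_iff R).mp ‹_›
  have hRI : ((maximalIdeal (R ⧸ I)).spanFinrank : WithBot ℕ∞) = ringKrullDim (R ⧸ I) :=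
    (isRegularLocalRing_iff (R ⧸ I)).mp ‹_›
  have key : ringKrullDim (R ⧸ Ideal.span (S : Set R)) + S.card = ringKrullDim (R ⧸ I) + S.card := by
    rw [hSdim, ← hR, ← hRI, ← hcount, hScard]
    push_cast
    rfl
  have hdimeq : ringKrullDim (R ⧸ Ideal.span (S : Set R)) = ringKrullDim (R ⧸ I) :=
    ENat.WithBot.add_natCast_cancel.mp key
  have hSIeq : Ideal.span (S : Set R) = I :=
    Literature.RingTheory.Depth.eq_of_le_of_ringKrullDim_quotient_eq hSI hdimeq
  refine ⟨S, hSG, hSIeq, ?_⟩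
  rw [← hdimeq]; exact hSdim

end Summit.ResolutionOfSingularities.ResolutionOfSingularities.Theorems.FRationalResolution.KatoRegularityCriterion

namespace Literature.AlgebraicGeometry.Resolution.LogChart

open IsLocalRing Summit.ResolutionOfSingularities.ResolutionOfSingularities.Theorems.FRationalResolution.KatoRegularityCriterion

universe v

variable {A : Type v} [CommRing A] [IsNoetherianRing A] {n : ℕ} {P : AddSubmonoid (Fin n → ℤ)}
  {φ : Multiplicative P →* A} {𝔭 : Ideal A} [𝔭.IsPrime]

/-- **Kato's regularity criterion, «regular ⇒ free» (one-chart form).** Let `φ : P → A` (`P ⊆ ℤⁿ` finitely generated,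
saturated; `A` Noetherian) be log regular at `𝔭` (Kato Def. (2.1)) and suppose `A_𝔭` is a REGULAR local ring. Then there is
a finite set `Q ⊆ P` of non-units (`φ(q) ∈ 𝔭`) with `#Q ≤ n − rk_ℤ F_𝔭^{gp}` such that every `p ∈ P` is an `ℕ`-combination of
`Q` modulo `ℤ F_𝔭` — i.e. the sharp monoid `P/F_𝔭`, of rank `n − rk F_𝔭^{gp}` when `P^{gp} = ℤⁿ`, is generated by (hence free
on) `Q`. (Kato's ideal is generated by `dim A_𝔭 − dim A_𝔭/I(𝔭) = n − rk F^{gp}` of its monomial generators,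
`exists_finset_subset_span_eq_of_isRegularLocalRing_quotient`; then `forall_exists_sub_sum_nsmul_mem_span_faceMonoid`.)
[cite: Kato1994, Def. (2.1), (3.2), (6.1)] [cite: BrunsHerzog1998, §2.2 Prop. 2.2.4] -/
theorem exists_generators_mod_faceMonoid_of_isRegularLocalRing (hP : P.FG)
    (hsat : ∀ (v : Fin n → ℤ) (k : ℕ), 0 < k → k • v ∈ P → v ∈ P) (hreg : IsLogRegularAt P φ 𝔭)
    (hR : IsRegularLocalRing (Localization.AtPrime 𝔭)) :
    ∃ Q : Finset P, (∀ q ∈ Q, φ (Multiplicative.ofAdd q) ∈ 𝔭) ∧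
      Q.card ≤ n - Module.finrank ℤ (Submodule.span ℤ ((fun p : P => (p : Fin n → ℤ)) '' face P φ 𝔭)) ∧
      ∀ p : P, ∃ c : P → ℕ,
        (p : Fin n → ℤ) - ∑ q ∈ Q, c q • (q : Fin n → ℤ) ∈ Submodule.span ℤ (faceMonoid P φ 𝔭 : Set (Fin n → ℤ)) := by
  classical
  haveI := hR
  set R := Localization.AtPrime 𝔭 with hRdef
  set I : Ideal R := (ideal P φ 𝔭).map (algebraMap A R) with hIdef
  haveI : IsRegularLocalRing (R ⧸ I) := hreg.1
  -- the monomial generators of Kato's ideal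
  set G : Set R := (fun q : P => algebraMap A R (φ (Multiplicative.ofAdd q))) '' {q | φ (Multiplicative.ofAdd q) ∈ 𝔭}
    with hGdef
  have hG : Ideal.span G = I := by
    rw [hIdef, ideal, Ideal.map_span, ← Set.image_comp]
    rfl
  obtain ⟨S, hSG, hSI, hdimS⟩ := exists_finset_subset_span_eq_of_isRegularLocalRing_quotient I G hG
  -- monomial preimages of the elements of `S`
  have hpre : ∀ s : ↥S, ∃ q : P, φ (Multiplicative.ofAdd q) ∈ 𝔭 ∧ algebraMap A R (φ (Multiplicative.ofAdd q)) = s := by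
    intro s
    obtain ⟨q, hq, hqs⟩ := hSG s.2
    exact ⟨q, hq, hqs⟩
  choose qf hqf𝔭 hqfs using hpre
  let Q : Finset P := Finset.univ.image qf
  have hQ𝔭 : ∀ q ∈ Q, φ (Multiplicative.ofAdd q) ∈ 𝔭 := by
    intro q hq
    obtain ⟨s, -, rfl⟩ := Finset.mem_image.1 hq
    exact hqf𝔭 s
  have hQcard : Q.card ≤ S.card := by
    calc Q.card ≤ (Finset.univ : Finset ↥S).card := Finset.card_image_le
      _ = S.card := by rw [Finset.card_univ, Fintype.card_coe]
  have hIQ : I ≤ Ideal.span ((fun q : P => algebraMap A R (φ (Multiplicative.ofAdd q))) '' (Q : Set P)) := by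
    rw [← hSI, Ideal.span_le]
    intro s hs
    refine Ideal.subset_span ⟨qf ⟨s, hs⟩, Finset.mem_coe.2 (Finset.mem_image.2 ⟨⟨s, hs⟩, Finset.mem_univ _, rfl⟩), ?_⟩
    exact hqfs ⟨s, hs⟩
  -- `#S = n − rk F^{gp}` from Kato (2.1)(ii)
  have hScard : S.card = n - Module.finrank ℤ (Submodule.span ℤ ((fun p : P => (p : Fin n → ℤ)) '' face P φ 𝔭)) := by
    have h2 := hreg.2
    have hRI : ((maximalIdeal (R ⧸ I)).spanFinrank : WithBot ℕ∞) = ringKrullDim (R ⧸ I) :=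
      (isRegularLocalRing_iff (R ⧸ I)).mp inferInstance
    rw [← hdimS, ← hRI] at h2
    have h3 : (((maximalIdeal (R ⧸ I)).spanFinrank + S.card : ℕ) : WithBot ℕ∞) =
        (((maximalIdeal (R ⧸ I)).spanFinrank +
          (n - Module.finrank ℤ (Submodule.span ℤ ((fun p : P => (p : Fin n → ℤ)) '' face P φ 𝔭))) : ℕ) : WithBot ℕ∞) := by
      push_cast; exact h2
    have h4 := (Nat.cast_injective (R := WithBot ℕ∞)) h3
    omega
  refine ⟨Q, hQ𝔭, hScard ▸ hQcard, ?_⟩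
  exact forall_exists_sub_sum_nsmul_mem_span_faceMonoid hP hsat hreg Q hQ𝔭 hIQ

end Literature.AlgebraicGeometry.Resolution.LogChart

end
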